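import Summits.HubbardSuperconductivity.HubbardSuperconductivity.Theorems.AnisotropyChordTransferFibre3Hole2L34a
import Summits.HubbardSuperconductivity.HubbardSuperconductivity.Theorems.AnisotropyChordTransferFibre3Hole2L34b
import Summits.HubbardSuperconductivity.HubbardSuperconductivity.Theorems.AnisotropyChordTransferFibre3Hole2L34c
import Summits.HubbardSuperconductivity.HubbardSuperconductivity.Theorems.AnisotropyChordTransferFibre3Hole2Cover

/-!
# Route `AnisotropyChord` / H0 rotor rung: ★ HOLE₂(.75) AT `L = 34` — `TwoHoleGap 34 (3/4·eps1 34)`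

The one-body spectral input of the GM₃ assembly `gm3_of_hole2` (p1 g23) at side length `L = 34` (first side lengths of the analytic
regime above the FIN range `9 ≤ L ≤ 32` of `…Hole2FinRange`): the Neumann gap of the rate-½ walk on the `34 × 34` torus with ANY two
vertices deleted is at least `¾ε₁(34)`.  Assembly of the kernel facts `checkRepsQ_34a…` (3 parts, the 170 `D₄`-classes `repList 34`)
via `checkRepsQ_append`, the identification with `repList 34` (`decide`), and `Hole2.twoHoleGap_of_checkRepsQ_repList` (`…Fibre3Hole2Cover`).
Prover seat `hubbard-h0-rotor-p3` g3; helper for stmt-HubbardSuperconductivity-19089 (`--supports`, helper class).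
WHAT THIS IS NOT: nothing here proves superconductivity in the Hubbard model (rotor TARGET as worded stays FALSE, g15 verdict); this
discharges, at ONE side length, ONE hypothesis (HOLE₂(.75)) of ONE conditional reduction (rung 19089). Tree imports only; no sorry.
-/

set_option linter.dupNamespace false
set_option autoImplicit false

namespace Summit.HubbardSuperconductivity.HubbardSuperconductivity.Theorems.AnisotropyChord.Transfer.Fibre3

namespace Hole2

/-- the kernel-fact parts list exactly `repList 34`. [folklore] -/
theorem repList_34_eq : repList 34 = reps34a ++ reps34b ++ reps34c := by
  decide +kernel

/-- every representative separation of the `34 × 34` torus passes the kernel check. [folklore] -/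
theorem checkRepsQ_repList_34 : checkRepsQ 34 (repList 34) = true := by
  rw [repList_34_eq]
  exact checkRepsQ_append (checkRepsQ_append (checkRepsQ_34a) checkRepsQ_34b) checkRepsQ_34c

/-- ★★★ HOLE₂(.75) AT `L = 34`: `TwoHoleGap 34 (3/4 * eps1 34)`, the spectral hypothesis of `gm3_of_hole2` at `L = 34`. [folklore] -/
theorem twoHoleGap_thirtyFour : TwoHoleGap 34 (3 / 4 * eps1 34) :=
  twoHoleGap_of_checkRepsQ_repList 34 checkRepsQ_repList_34

end Hole2

end Summit.HubbardSuperconductivity.HubbardSuperconductivity.Theorems.AnisotropyChord.Transfer.Fibre3
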